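import Literature.AlgebraicGeometry.Frobenioids.RigiditySlimness
import Literature.AlgebraicGeometry.Frobenioids.PadicFrobenioidThm12
import Literature.AlgebraicGeometry.Frobenioids.PadicFrobenioidDatumLemmas
import Literature.AlgebraicGeometry.Frobenioids.ModelFrobenioidNormalized
import Literature.AlgebraicGeometry.Frobenioids.PadicUnitsDivisible
import Literature.AlgebraicGeometry.Frobenioids.PadicFrobenioidUnitGroups
import HarnessLib

/-!
# Frobenioids II, Theorem 1.2 (iv): a `p`-adic Frobenioid over a slim base is slim

Mochizuki, *The geometry of Frobenioids II*, Kyushu J. Math. **62** (2008), §1, Theorem 1.2 (iv),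
kurims p. 9 [cite: MochizukiFrdII2008, Thm 1.2 (iv) p.9]: "If `D` is slim, and `Λ ∈ {ℤ, ℝ}`, then `C`
is also slim", with the printed proof "follows formally from [FrdI], Proposition 1.13, (iii) [since, by
assertion (i) …, condition (b) of loc. cit. is always satisfied by objects of `C`]". PROOF-ONLY assembly
for `Λ = ℤ` (node `FrdII:Thm1.2(iv)`, seat abc-iut-L1-d8) of:
* [FrdI] Prop. 1.13 (iii) (`PreFrobenioid.isSlim`, abc-iut-L1-t1, `RigiditySlimness.lean`);
* condition (b): every object `X` of the model Frobenioid is quasi-Frobenius-trivial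
  (`ModelFrobenioidAmpleness`, via `Div_B`-cofinality) and Frobenius-normalized
  (`ModelFrobenioidNormalized`), the identity being a co-angular pre-step; and an infinitely divisible
  element of `O^×(X) ≅ O_{K_X}^×` is trivial (`PadicUnitsDivisible`: an infinitely divisible unit of a
  finite extension of `ℚ_p` is `1`).
One input is taken as a hypothesis and named: `IsFrobenioid d.structureFunctor` (= [FrdI] Thm. 5.2 (ii)
for the datum, found's `ModelFrobenioid.isFrobenioid` under t4's `Datum.IsMonoidData`); the unit
comparison `O^×(X) ↪ O_{K_X}^×` is abc-iut-L1-d10's `Datum.exists_unitsHom`. No definitions.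
-/

namespace Literature.AlgebraicGeometry.Frobenioids

namespace PadicFrd

namespace Datum

open CategoryTheory Opposite ValuativeRel

universe v u

variable {D : Type u} [Category.{v} D] {p : ℕ} [Fact p.Prime] (d : Datum D p)

/-- **Theorem 1.2 (iv)** (FrdII p. 9), `Λ = ℤ`: "If `D` is slim, then `C` is also slim" — for the
`p`-adic Frobenioid of `d`, GIVEN that it is a Frobenioid ([FrdI] Thm. 5.2 (ii)) and an injective unit
comparison `O^×(X) → O_{K_X}^×` for every object `X`. Route = the printed one: [FrdI] Prop. 1.13 (iii)
with its condition (b) — `⋂_n (O^×(X))^n = {1}` by `PadicUnitsDivisible` (an infinitely divisible unit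
of a finite extension of `ℚ_p` is `1`), and `id_X` a co-angular pre-step from the quasi-Frobenius-trivial,
Frobenius-normalized object `X`. [cite: MochizukiFrdII2008, Thm 1.2 (iv) p.9] -/
theorem thm12_iv_of_isFrobenioid (hF : PreFrobenioid.IsFrobenioid d.structureFunctor)
    (hθ : ∀ X : d.frobenioid, ∃ θ : PreFrobenioid.unitsSubgroup d.structureFunctor X →* (d.fld X.base)ˣ,
      Function.Injective θ ∧ ∀ v, valuation (d.fld X.base) (θ v : d.fld X.base) = 1) :
    Thm12_iv d := by
  intro hD
  refine PreFrobenioid.isSlim hF hD fun X => Or.inr ⟨?_, ?_⟩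
  · -- (b), first clause: an infinitely divisible element of `O^×(X)` is trivial
    intro v hv hdiv
    obtain ⟨θ, hθinj, hθval⟩ := hθ X
    obtain ⟨inst, hfin, hc⟩ := (d.isPadicLocal X.base).exists_finite
    letI := inst
    haveI := hfin
    have key : ((θ ⟨v, hv⟩ : (d.fld X.base)ˣ) : d.fld X.base) = 1 := by
      refine eq_one_of_valuation_eq_one_of_forall_exists_pow_eq hc (hθval ⟨v, hv⟩) fun n hn => ?_
      obtain ⟨u, hu, hun⟩ := hdiv ⟨n, hn⟩
      refine ⟨((θ ⟨u, hu⟩ : (d.fld X.base)ˣ) : d.fld X.base), ?_⟩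
      have h : (⟨u, hu⟩ : PreFrobenioid.unitsSubgroup d.structureFunctor X) ^ n = ⟨v, hv⟩ :=
        Subtype.ext hun
      rw [← Units.val_pow_eq_pow_val, ← map_pow, h]
    have h1 : θ ⟨v, hv⟩ = 1 := Units.val_eq_one.mp key
    have h2 : (⟨v, hv⟩ : PreFrobenioid.unitsSubgroup d.structureFunctor X) = 1 :=
      hθinj (h1.trans (map_one θ).symm)
    exact congrArg Subtype.val h2
  · -- (b), second clause: `id_X` is a co-angular pre-step; `X` is quasi-Frobenius-trivial and
    -- Frobenius-normalized
    exact ⟨X, 𝟙 X,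
      ⟨PreFrobenioid.isCoAngular_of_isIso d.structureFunctor hF.isPreFrobenioid.isTotallyEpimorphic (𝟙 X),
        PreFrobenioid.isPreStep_of_isIso d.structureFunctor (𝟙 X)⟩,
      ModelFrobenioid.isQuasiFrobeniusTrivial_of_cofinal d.divB_cofinal X,
      ModelFrobenioid.isFrobeniusNormalized X⟩

/-- **Theorem 1.2 (iv)** (FrdII p. 9), `Λ = ℤ`, for the `p`-adic Frobenioid of `d`, GIVEN only that it is a
Frobenioid ([FrdI] Thm. 5.2 (ii) under the standing hypothesis `d.IsMonoidData`): "If `D` is slim, then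
`C` is also slim" — the unit comparison `O^×(X) ↪ O_{K_X}^×` being abc-iut-L1-d10's
`Datum.exists_unitsHom`. [cite: MochizukiFrdII2008, Thm 1.2 (iv) p.9] -/
theorem thm12_iv_of_isFrobenioid' (hF : PreFrobenioid.IsFrobenioid d.structureFunctor) : Thm12_iv d :=
  d.thm12_iv_of_isFrobenioid hF fun X => by
    obtain ⟨θ, h1, h2, -⟩ := d.exists_unitsHom X
    exact ⟨θ, h1, h2⟩

end Datum

end PadicFrd

end Literature.AlgebraicGeometry.Frobenioids
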